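import Summits.ValiantsHypothesis.ValiantsHypothesis.Theorems.LacunarySymmetroidMatrixDescartesFiniteSectorSectorCeilingMTwo

/-!
# `MatrixDescartes` — line «finite»: PAIR-SUM BITMASKS for the kernel checks of the `m = 2` finite registers (bridge theorems)

HONEST FRAMING.  Object-search cell `pub-symmetroid`, seat val-sym-door-p5 g8.  HELPER material for the crux item `stmt-ValiantsHypothesis-18050`
(`Theses.LacunarySymmetroid.MatrixDescartes`) with NO closure claim and no mathematical content of its own: the finite cores of the `m = 2`
stamp / sector registers (`…FiniteSectorStampCeilingMTwo(High)`, `…FiniteSectorSectorCeilingMTwo…`) are pruned nested enumerations decided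
in the kernel; from `K = 9` (stamp) / `K = 7` (sector) on, the pair-sum predicate `∃ x ∈ l, ∃ y ∈ l, x + y = r` evaluated pointwise is too
slow / memory-hungry for one kernel check.  Here the pair-sum SET of a value list `l` is carried as ONE natural number (bit `r` set iff `r` is a
pair sum), written WITHOUT any new definition as the closed fold
`PF l = l.foldr (fun x acc => l.foldr (fun y acc => acc ||| 2 ^ (x + y)) acc) 0`,
so that «`[0, t)` covered by pair sums» is the single accelerated atom `PF l % 2 ^ t = 2 ^ t - 1` and «step-≤-2 chain alive below `t`» is
`(PF l ||| PF l / 2) % 2 ^ t = 2 ^ t - 1` (`Nat.lor`, `pow`, `mod`, `div` are GMP operations in the kernel).  This file proves the three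
bridge facts the transfer proofs need (membership ⇒ bit; all bits ⇒ full residue; alive chain ⇒ full residue of `P ||| P/2`).  Nothing here
bears on the crux, the doors, or `VP ≠ VNP`.
[folklore] Elementary bit bookkeeping (`Nat.testBit`); no citation is load-bearing.
-/

-- `Summit.ValiantsHypothesis.ValiantsHypothesis.…` repeats a component by the D-0017 layout
-- (single-conjunct summit), which the `dupNamespace` linter flags; the name is mandated.
set_option linter.dupNamespace false

namespace Summit.ValiantsHypothesis.ValiantsHypothesis.Theorems.LacunarySymmetroidMatrixDescartes.FiniteSector

/-! ## Bit bookkeeping for pair-sum masks -/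

/-- If all bits of `M` below `t` are set then `M % 2^t = 2^t - 1`. [folklore] -/
theorem maskFull_of_testBit {M t : ℕ} (h : ∀ r < t, M.testBit r = true) : M % 2 ^ t = 2 ^ t - 1 := by
  apply Nat.eq_of_testBit_eq
  intro i
  rw [Nat.testBit_mod_two_pow, Nat.testBit_two_pow_sub_one]
  by_cases hi : i < t
  · simp [hi, h i hi]
  · simp [hi]

/-- If for every `r < t` bit `r` or bit `r+1` of `P` is set («step-≤-2 chain alive below `t`») then `(P ||| P/2) % 2^t = 2^t - 1`. [folklore] -/
theorem maskAlive_of_testBit {P t : ℕ} (h : ∀ r < t, P.testBit r = true ∨ P.testBit (r + 1) = true) :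
    (P ||| P / 2) % 2 ^ t = 2 ^ t - 1 := by
  apply maskFull_of_testBit
  intro r hr
  rw [Nat.testBit_lor]
  rcases h r hr with h1 | h1
  · simp [h1]
  · rw [Nat.testBit_succ] at h1
    simp [h1]

/-- Bits of the inner fold `l₂.foldr (fun y acc => acc ||| 2 ^ (x + y)) acc`: bit `r` is set iff it is set in `acc` or `r = x + y` for some
`y ∈ l₂`. [folklore] -/
theorem testBit_pairFoldInner (x : ℕ) (l₂ : List ℕ) (acc r : ℕ) :
    (l₂.foldr (fun y acc => acc ||| 2 ^ (x + y)) acc).testBit r = true ↔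
      (acc.testBit r = true ∨ ∃ y ∈ l₂, x + y = r) := by
  induction l₂ generalizing acc with
  | nil => simp
  | cons y ys ih =>
    simp only [List.foldr_cons, Nat.testBit_lor, Bool.or_eq_true, Nat.testBit_two_pow, decide_eq_true_eq,
      List.mem_cons, exists_eq_or_imp]
    rw [ih]
    constructor
    · rintro ((h | h) | h)
      exacts [Or.inl h, Or.inr (Or.inr h), Or.inr (Or.inl h)]
    · rintro (h | h | h)
      exacts [Or.inl (Or.inl h), Or.inr h, Or.inl (Or.inr h)]

/-- Bits of the PAIR-SUM MASK fold: bit `r` of `l.foldr (fun x acc => l₂.foldr (fun y acc => acc ||| 2 ^ (x + y)) acc) acc` is set iff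
it is set in `acc` or `r = x + y` with `x ∈ l`, `y ∈ l₂`. [folklore] -/
theorem testBit_pairFold (l l₂ : List ℕ) (acc r : ℕ) :
    (l.foldr (fun x acc => l₂.foldr (fun y acc => acc ||| 2 ^ (x + y)) acc) acc).testBit r = true ↔
      (acc.testBit r = true ∨ ∃ x ∈ l, ∃ y ∈ l₂, x + y = r) := by
  induction l generalizing acc with
  | nil => simp
  | cons x xs ih =>
    simp only [List.foldr_cons, List.mem_cons, exists_eq_or_imp]
    rw [testBit_pairFoldInner, ih]
    constructor
    · rintro ((h | h) | h)
      exacts [Or.inl h, Or.inr (Or.inr h), Or.inr (Or.inl h)]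
    · rintro (h | h | h)
      exacts [Or.inl (Or.inl h), Or.inr h, Or.inl (Or.inr h)]

/-- **Membership ⇒ bit.**  A pair sum `r = x + y` (`x, y ∈ l`) sets bit `r` of the pair-sum mask
`l.foldr (fun x acc => l.foldr (fun y acc => acc ||| 2 ^ (x + y)) acc) 0`. [folklore] -/
theorem testBit_pairFold_of_mem {l : List ℕ} {r : ℕ} (h : ∃ x ∈ l, ∃ y ∈ l, x + y = r) :
    (l.foldr (fun x acc => l.foldr (fun y acc => acc ||| 2 ^ (x + y)) acc) 0).testBit r = true :=
  (testBit_pairFold l l 0 r).mpr (Or.inr h)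

/-- **Bit ⇒ membership** (converse, for reading located masks back). [folklore] -/
theorem mem_of_testBit_pairFold {l : List ℕ} {r : ℕ}
    (h : (l.foldr (fun x acc => l.foldr (fun y acc => acc ||| 2 ^ (x + y)) acc) 0).testBit r = true) :
    ∃ x ∈ l, ∃ y ∈ l, x + y = r := by
  rcases (testBit_pairFold l l 0 r).mp h with h0 | h0
  · simp at h0
  · exact h0

end Summit.ValiantsHypothesis.ValiantsHypothesis.Theorems.LacunarySymmetroidMatrixDescartes.FiniteSector
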